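import Mathlib
import Summits.KontsevichZagierPeriods.KontsevichZagierPeriods.Theorems.SoloInformedLegendreArcsine
import Summits.KontsevichZagierPeriods.KontsevichZagierPeriods.Theorems.SoloInformedLemniscateValues
import HarnessLib
import HarnessLib.Audit

/-!
# SoloInformed — Legendre relation VIII: the lemniscatic modulus `k² = ½` by two substitution moves

Solo-informed residency (s33), file VIII of the Legendre chain.  At the self-complementary modulus
`k = k' = 1/√2` the complete elliptic integral of the first kind is a Beta value:

  `⟦K_{1/2}⟧ = ⟦[pt, √2/4]⟧ · ⟦β(¼,½)⟧`  in the formal period ring `P`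
  (`soloInformed_ellipticK_half_eq_beta`), hence `K(1/√2) = (√2/4)·B(¼,½) = Γ(¼)²/(4√π)`
  (`soloInformed_ellipticK_half_value`, `soloInformed_ellipticK_half_value_gamma`).

The chain of moves (all rule (2), via the lift lemma of s23):
* `x = √2·t/√(1+t²)` maps `(0,1)` onto `(0,1)` and pulls `[(0,1), ((1−x²)(1−x²/2))^{-1/2}]` back to
  `[(0,1), √2·(1−t⁴)^{-1/2}]` (`soloInformed_ellipticK_half_lemniscatic`);
* `u = t⁴` turns the latter into `(√2/4)·[(0,1), u^{-3/4}(1−u)^{-1/2}] = (√2/4)·β(¼,½)`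
  (`soloInformed_quartic_beta`).

This is the `n = 1` (lemniscatic) input for the decided elliptic sector of file IX: together with
THEOREM XVII (Legendre's relation in `P`) it places `K(1/√2), E(1/√2)` against Chudnovsky's
theorem on `π, Γ(¼)`.

References: Whittaker–Watson, *A Course of Modern Analysis*, §§ 22.3, 22.8 (lemniscate functions);
this work (solo-informed s22 `SoloInformedLemniscateValues`, s23 `SoloInformedLiftMoves`, s33).
-/

noncomputable section

open MeasureTheory Set Filter
open scoped Classical

open Literature.NumberTheory.Transcendental Literature.NumberTheory.Transcendental.KZ
open Literature.ModelTheory.ExponentialFields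

namespace Summit.KontsevichZagierPeriods.KontsevichZagierPeriods.Theorems

/-! ### The quartic representation `[(0,1), √2·(1−t⁴)^{-1/2}]` -/

/-- `√2/4` is algebraic (the scalar of the lemniscatic identity). [folklore] -/
theorem soloInformed_isAlgebraic_sqrt_two_div_four : IsAlgebraic ℚ (√2 / 4 : ℝ) := by
  have h2a : IsAlgebraic ℚ (√2 : ℝ) :=
    ⟨Polynomial.X ^ 2 - Polynomial.C 2, (Polynomial.monic_X_pow_sub_C (2 : ℚ) two_ne_zero).ne_zero,
      by simp [Real.sq_sqrt]⟩
  rw [div_eq_mul_inv]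
  exact h2a.mul (isAlgebraic_nat (R := ℚ) (A := ℝ) 4).inv

/-- **The quartic (lemniscatic) representation** `[(0,1), √2·(1−t⁴)^{-1/2}]` exists: semialgebraic,
and integrable by domination with `√2·(1−t)^{-1/2}`. [this work] -/
theorem soloInformed_exists_quartic_rep :
    ∃ Q : IntegralRep 1, Q.domain = {x : Fin 1 → ℝ | x 0 ∈ Ioo (0:ℝ) 1} ∧
      ∀ x, Q.integrand x = √2 * (√(1 - x 0 ^ 4))⁻¹ := by
  have hsq := BallPeeling.isSemialgebraic_posIoo
  have h2a : IsAlgebraic ℚ (√2 : ℝ) :=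
    ⟨Polynomial.X ^ 2 - Polynomial.C 2, (Polynomial.monic_X_pow_sub_C (2 : ℚ) two_ne_zero).ne_zero,
      by simp [Real.sq_sqrt]⟩
  have hsa : IsSemialgebraicFunOn ℚ {x : Fin 1 → ℝ | x 0 ∈ Ioo (0:ℝ) 1}
      (fun x : Fin 1 → ℝ => √2 * (√(1 - x 0 ^ 4))⁻¹) := by
    refine ((isSemialgebraicFunOn_const_of_isAlgebraic hsq h2a).mul_holds
      (soloInformed_sa_inv_sqrt_aeval hsq (1 - MvPolynomial.X 0 ^ 4) fun x hx => ?_)).congr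
      fun x _ => ?_
    · have h : x 0 ∈ Ioo (0:ℝ) 1 := hx
      simp only [map_sub, map_one, map_pow, MvPolynomial.aeval_X]
      have h4 : x 0 ^ 4 < 1 := pow_lt_one₀ h.1.le h.2 four_ne_zero
      linarith
    · simp only [Pi.mul_apply, map_sub, map_one, map_pow, MvPolynomial.aeval_X]
  have hint : IntegrableOn (fun x : Fin 1 → ℝ => √2 * (√(1 - x 0 ^ 4))⁻¹)
      {x : Fin 1 → ℝ | x 0 ∈ Ioo (0:ℝ) 1} := by
    refine soloInformed_integrableOn_of_le_inv_sqrt_prod hsq hsa ∅ {0} ∅ {0} (√2) ∅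
      measure_empty (fun x hx _ j => ?_) (fun x _ hc => ?_)
    · have h : x 0 ∈ Ioo (0:ℝ) 1 := hx
      fin_cases j
      exact h
    · have hx := hc 0
      have hx4 : x 0 ^ 4 ≤ x 0 := by
        simpa using pow_le_pow_of_le_one hx.1.le hx.2.le (show 1 ≤ 4 by norm_num)
      have h1 : (√(1 - x 0 ^ 4))⁻¹ ≤ (√(1 - x 0))⁻¹ :=
        inv_anti₀ (Real.sqrt_pos.2 (by linarith [hx.2])) (Real.sqrt_le_sqrt (by linarith))
      have h0 : 0 ≤ √2 * (√(1 - x 0 ^ 4))⁻¹ := by positivity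
      have hX : 0 ≤ (√(1 - x 0))⁻¹ := by positivity
      have h2 : (0:ℝ) ≤ √2 := Real.sqrt_nonneg 2
      rw [abs_of_nonneg h0, Finset.prod_empty, Finset.prod_singleton]
      nlinarith [mul_le_mul_of_nonneg_left h1 h2]
  exact ⟨⟨_, _, hsq, hsa, hint⟩, rfl, fun x => rfl⟩

/-! ### Move 1: `x = √2·t/√(1+t²)` -/

/-- The substitution `g(t) = √2·t/√(1+t²)` maps `(0,1)` into `(0,1)`. [folklore] -/
theorem soloInformed_lemniscatic_subst_mem {t : ℝ} (ht : t ∈ Ioo (0:ℝ) 1) :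
    √2 * t * (√(1 + t ^ 2))⁻¹ ∈ Ioo (0:ℝ) 1 := by
  have hb : 0 < 1 + t ^ 2 := by positivity
  have hb0 : 0 < √(1 + t ^ 2) := Real.sqrt_pos.2 hb
  have ht0 := ht.1
  refine ⟨by positivity, ?_⟩
  rw [← div_eq_mul_inv, div_lt_one hb0, Real.lt_sqrt (by positivity)]
  nlinarith [Real.sq_sqrt (zero_le_two : (0:ℝ) ≤ 2), ht.1, ht.2]

/-- **Move 1.** The substitution `x = √2·t/√(1+t²)` (rule (2)) pulls the representation
`K_{1/2} = [(0,1), ((1−x²)(1−x²/2))^{-1/2}]` back to the quartic representation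
`[(0,1), √2·(1−t⁴)^{-1/2}]`. [this work] -/
theorem soloInformed_ellipticK_half_lemniscatic (K Q : IntegralRep 1)
    (hKd : K.domain = {x : Fin 1 → ℝ | x 0 ∈ Ioo (0:ℝ) 1})
    (hKi : EqOn K.integrand
      (fun x => (√(1 - x 0 ^ 2))⁻¹ * (√(1 - (1 / 2 : ℝ) * x 0 ^ 2))⁻¹) K.domain)
    (hQd : Q.domain = {x : Fin 1 → ℝ | x 0 ∈ Ioo (0:ℝ) 1})
    (hQi : ∀ x, Q.integrand x = √2 * (√(1 - x 0 ^ 4))⁻¹) :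
    of Q - of K ∈ changeOfVariablesRel := by
  have hsq := BallPeeling.isSemialgebraic_posIoo
  have h2a : IsAlgebraic ℚ (√2 : ℝ) :=
    ⟨Polynomial.X ^ 2 - Polynomial.C 2, (Polynomial.monic_X_pow_sub_C (2 : ℚ) two_ne_zero).ne_zero,
      by simp [Real.sq_sqrt]⟩
  have h2 : (0:ℝ) < √2 := Real.sqrt_pos.2 two_pos
  have h22 : (√2 : ℝ) ^ 2 = 2 := Real.sq_sqrt zero_le_two
  refine soloInformed_lift_mem_changeOfVariablesRel Q K
    (g := fun t => √2 * t * (√(1 + t ^ 2))⁻¹)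
    (g' := fun t => √2 * (√(1 + t ^ 2))⁻¹ / (1 + t ^ 2))
    (S := Ioo (0:ℝ) 1) (T := Ioo (0:ℝ) 1) hQd hKd ?_ (fun t _ => ?_) ?_ ?_ ?_
  · -- the substitution is a semialgebraic map
    rw [hQd]
    refine IsSemialgebraicMapOn.of_forall hsq fun j => ?_
    refine (((isSemialgebraicFunOn_const_of_isAlgebraic hsq h2a).mul_holds
      (isSemialgebraicFunOn_aeval hsq (MvPolynomial.X 0))).mul_holds
      (soloInformed_sa_inv_sqrt_aeval hsq (1 + MvPolynomial.X 0 ^ 2) fun x _ => by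
        simp only [map_add, map_one, map_pow, MvPolynomial.aeval_X]; positivity)).congr fun x _ => ?_
    simp only [Pi.mul_apply, map_add, map_one, map_pow, MvPolynomial.aeval_X, soloInformedLift]
  · -- its derivative
    have hb : 0 < 1 + t ^ 2 := by positivity
    have hd : HasDerivAt (fun y : ℝ => 1 + y ^ 2) (2 * t) t := by
      simpa using (soloInformed_hasDerivAt_sq t).const_add 1
    have hinv := soloInformed_hasDerivAt_inv_sqrt hd hb (-t / (1 + t ^ 2))
      (by field_simp)
    have hmul := ((hasDerivAt_id' t).const_mul (√2)).mul hinv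
    refine hmul.congr_deriv ?_
    field_simp
    ring
  · -- injective on `(0,1)`
    intro a ha b hb h
    have hpa : 0 < √(1 + a ^ 2) := Real.sqrt_pos.2 (by positivity)
    have hpb : 0 < √(1 + b ^ 2) := Real.sqrt_pos.2 (by positivity)
    have hsa : √(1 + a ^ 2) ^ 2 = 1 + a ^ 2 := Real.sq_sqrt (by positivity)
    have hsb : √(1 + b ^ 2) ^ 2 = 1 + b ^ 2 := Real.sq_sqrt (by positivity)
    have h' : √2 * a * (√(1 + a ^ 2))⁻¹ = √2 * b * (√(1 + b ^ 2))⁻¹ := h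
    have e : a * √(1 + b ^ 2) = b * √(1 + a ^ 2) := by
      field_simp at h'
      nlinarith [h']
    have e2 : a ^ 2 * (1 + b ^ 2) = b ^ 2 * (1 + a ^ 2) := by
      have := congrArg (fun y : ℝ => y ^ 2) e
      simpa only [mul_pow, hsa, hsb] using this
    have e3 : a ^ 2 = b ^ 2 := by nlinarith [e2]
    exact (pow_left_inj₀ ha.1.le hb.1.le two_ne_zero).mp e3
  · -- onto `(0,1)`: the inverse is `y ↦ y/√(2−y²)`
    ext y
    constructor
    · rintro ⟨t, ht, rfl⟩
      exact soloInformed_lemniscatic_subst_mem ht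
    · intro hy
      have hs : 0 < 2 - y ^ 2 := by nlinarith [hy.1, hy.2]
      have hs0 : 0 < √(2 - y ^ 2) := Real.sqrt_pos.2 hs
      have hs2 : √(2 - y ^ 2) ^ 2 = 2 - y ^ 2 := Real.sq_sqrt hs.le
      refine ⟨y / √(2 - y ^ 2), ⟨by have := hy.1; positivity, ?_⟩, ?_⟩
      · rw [div_lt_one hs0, Real.lt_sqrt hy.1.le]
        nlinarith [hy.1, hy.2]
      · have h1t : 1 + (y / √(2 - y ^ 2)) ^ 2 = 2 / √(2 - y ^ 2) ^ 2 := by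
          field_simp
          linear_combination hs2
        show √2 * (y / √(2 - y ^ 2)) * (√(1 + (y / √(2 - y ^ 2)) ^ 2))⁻¹ = y
        rw [h1t, Real.sqrt_div' _ (sq_nonneg _), Real.sqrt_sq hs0.le]
        field_simp
  · -- the integrands match: `√2·(1−t⁴)^{-1/2} = ((1−g²)(1−g²/2))^{-1/2}·g'`
    intro x hx
    have ht : x 0 ∈ Ioo (0:ℝ) 1 := by rw [hQd] at hx; exact hx
    have hb : 0 < 1 + x 0 ^ 2 := by positivity
    have ha : 0 < 1 - x 0 ^ 2 := by nlinarith [ht.1, ht.2]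
    have hb0 : 0 < √(1 + x 0 ^ 2) := Real.sqrt_pos.2 hb
    have ha0 : 0 < √(1 - x 0 ^ 2) := Real.sqrt_pos.2 ha
    have hb2 : √(1 + x 0 ^ 2) ^ 2 = 1 + x 0 ^ 2 := Real.sq_sqrt hb.le
    have ha2 : √(1 - x 0 ^ 2) ^ 2 = 1 - x 0 ^ 2 := Real.sq_sqrt ha.le
    have hmem : soloInformedLift (fun t => √2 * t * (√(1 + t ^ 2))⁻¹) x ∈ K.domain := by
      rw [hKd]; exact soloInformed_lemniscatic_subst_mem ht
    rw [hQi, hKi hmem]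
    simp only [soloInformedLift]
    have e1 : 1 - (√2 * x 0 * (√(1 + x 0 ^ 2))⁻¹) ^ 2 =
        (√(1 - x 0 ^ 2) * (√(1 + x 0 ^ 2))⁻¹) ^ 2 := by
      rw [mul_pow, mul_pow, mul_pow, inv_pow, h22, ha2, hb2]
      field_simp
      ring
    have e2 : 1 - 1 / 2 * (√2 * x 0 * (√(1 + x 0 ^ 2))⁻¹) ^ 2 = ((√(1 + x 0 ^ 2))⁻¹) ^ 2 := by
      rw [mul_pow, mul_pow, inv_pow, h22, hb2]
      field_simp
      ring
    have e3 : √(1 - x 0 ^ 4) = √(1 - x 0 ^ 2) * √(1 + x 0 ^ 2) := by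
      rw [show 1 - x 0 ^ 4 = (1 - x 0 ^ 2) * (1 + x 0 ^ 2) by ring, Real.sqrt_mul ha.le]
    rw [e1, e2, Real.sqrt_sq (by positivity), Real.sqrt_sq (by positivity),
      abs_of_pos (by positivity), e3]
    have hane : √(1 - x 0 ^ 2) ≠ 0 := ha0.ne'
    have hbne : √(1 + x 0 ^ 2) ≠ 0 := hb0.ne'
    set a := √(1 - x 0 ^ 2) with ha_def
    set b := √(1 + x 0 ^ 2) with hb_def
    rw [← hb2]
    field_simp

/-! ### Move 2: `u = t⁴` -/

/-- **Move 2.** The substitution `u = t⁴` (rule (2)) turns the quartic representation into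
`(√2/4)·[(0,1), u^{-3/4}(1−u)^{-1/2}] = (√2/4)·β(¼,½)`. [this work] -/
theorem soloInformed_quartic_beta (Q B : IntegralRep 1)
    (hQd : Q.domain = {x : Fin 1 → ℝ | x 0 ∈ Ioo (0:ℝ) 1})
    (hQi : ∀ x, Q.integrand x = √2 * (√(1 - x 0 ^ 4))⁻¹)
    (hBd : B.domain = {t | t 0 ∈ Ioo (0:ℝ) 1})
    (hBi : EqOn B.integrand
      (fun t => (t 0) ^ (((1 / 4 : ℚ) : ℝ) - 1) * (1 - t 0) ^ (((1 / 2 : ℚ) : ℝ) - 1)) B.domain)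
    (hc : IsAlgebraic ℚ (√2 / 4 : ℝ)) :
    of Q - of (B.constMul (√2 / 4) hc) ∈ changeOfVariablesRel := by
  have hsq := BallPeeling.isSemialgebraic_posIoo
  refine soloInformed_lift_mem_changeOfVariablesRel Q (B.constMul _ hc) (g := fun t => t ^ 4)
    (g' := fun t => 4 * t ^ 3) (S := Ioo (0:ℝ) 1) (T := Ioo (0:ℝ) 1) hQd
    (by rw [IntegralRep.domain_constMul, hBd]) ?_ (fun t _ => ?_) ?_ ?_ ?_
  · rw [hQd]
    refine IsSemialgebraicMapOn.of_forall hsq fun j => ?_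
    refine (isSemialgebraicFunOn_aeval hsq (MvPolynomial.X 0 ^ 4)).congr fun x _ => ?_
    simp only [map_pow, MvPolynomial.aeval_X, soloInformedLift]
  · simpa using hasDerivAt_pow 4 t
  · intro a ha b hb h
    exact (pow_left_inj₀ ha.1.le hb.1.le four_ne_zero).mp h
  · ext u
    constructor
    · rintro ⟨t, ht, rfl⟩
      exact ⟨by have := ht.1; positivity, pow_lt_one₀ ht.1.le ht.2 four_ne_zero⟩
    · intro hu
      refine ⟨u ^ (1 / 4 : ℝ), ⟨Real.rpow_pos_of_pos hu.1 _, Real.rpow_lt_one hu.1.le hu.2 (by norm_num)⟩, ?_⟩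
      show (u ^ (1 / 4 : ℝ)) ^ 4 = u
      rw [← Real.rpow_natCast, ← Real.rpow_mul hu.1.le]
      norm_num
  · intro x hx
    have ht : x 0 ∈ Ioo (0:ℝ) 1 := by rw [hQd] at hx; exact hx
    have ht4 : x 0 ^ 4 ∈ Ioo (0:ℝ) 1 :=
      ⟨by have := ht.1; positivity, pow_lt_one₀ ht.1.le ht.2 four_ne_zero⟩
    have hmem : soloInformedLift (fun t => t ^ 4) x ∈ B.domain := by rw [hBd]; exact ht4
    have h1 : 0 < 1 - x 0 ^ 4 := by linarith [ht4.2]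
    have hx3 : 0 < x 0 ^ 3 := by have := ht.1; positivity
    have hx0 : x 0 ≠ 0 := ht.1.ne'
    rw [hQi, IntegralRep.integrand_constMul]
    simp only []
    rw [hBi hmem]
    simp only [soloInformedLift]
    have e1 : (x 0 ^ 4) ^ (((1 / 4 : ℚ) : ℝ) - 1) = (x 0 ^ 3)⁻¹ := by
      rw [← Real.rpow_natCast (x 0) 4, ← Real.rpow_mul ht.1.le,
        show ((4:ℕ):ℝ) * ((((1 / 4 : ℚ)) : ℝ) - 1) = -((3:ℕ):ℝ) by norm_num,
        Real.rpow_neg ht.1.le, Real.rpow_natCast]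
    rw [e1, ← soloInformed_inv_sqrt_eq_rpow h1, abs_of_pos (by positivity)]
    field_simp

/-! ### The class identity and the value -/

/-- **`K(1/√2)` is KZ-equivalent to `(√2/4)·β(¼,½)`** (two substitution moves). [this work] -/
theorem soloInformed_ellipticK_half_equivalent_beta (K B : IntegralRep 1)
    (hKd : K.domain = {x : Fin 1 → ℝ | x 0 ∈ Ioo (0:ℝ) 1})
    (hKi : EqOn K.integrand
      (fun x => (√(1 - x 0 ^ 2))⁻¹ * (√(1 - (1 / 2 : ℝ) * x 0 ^ 2))⁻¹) K.domain)
    (hBd : B.domain = {t | t 0 ∈ Ioo (0:ℝ) 1})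
    (hBi : EqOn B.integrand
      (fun t => (t 0) ^ (((1 / 4 : ℚ) : ℝ) - 1) * (1 - t 0) ^ (((1 / 2 : ℚ) : ℝ) - 1)) B.domain)
    (hc : IsAlgebraic ℚ (√2 / 4 : ℝ)) :
    Equivalent K (B.constMul (√2 / 4) hc) := by
  obtain ⟨Q, hQd, hQi⟩ := soloInformed_exists_quartic_rep
  have h1 := changeOfVariablesRel_subset_relations
    (soloInformed_ellipticK_half_lemniscatic K Q hKd hKi hQd hQi)
  have h2 := changeOfVariablesRel_subset_relations (soloInformed_quartic_beta Q B hQd hQi hBd hBi hc)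
  have e : of K - of (B.constMul (√2 / 4) hc) = (of Q - of (B.constMul (√2 / 4) hc)) - (of Q - of K) := by
    abel
  show of K - of (B.constMul (√2 / 4) hc) ∈ relations
  rw [e]
  exact relations.sub_mem h2 h1

/-- **THEOREM XVII-L (class form).** `⟦K_{1/2}⟧ = ⟦[pt, √2/4]⟧ · ⟦β(¼,½)⟧` in the formal period
ring. [this work] -/
theorem soloInformed_ellipticK_half_eq_beta (K B : IntegralRep 1)
    (hKd : K.domain = {x : Fin 1 → ℝ | x 0 ∈ Ioo (0:ℝ) 1})
    (hKi : EqOn K.integrand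
      (fun x => (√(1 - x 0 ^ 2))⁻¹ * (√(1 - (1 / 2 : ℝ) * x 0 ^ 2))⁻¹) K.domain)
    (hBd : B.domain = {t | t 0 ∈ Ioo (0:ℝ) 1})
    (hBi : EqOn B.integrand
      (fun t => (t 0) ^ (((1 / 4 : ℚ) : ℝ) - 1) * (1 - t 0) ^ (((1 / 2 : ℚ) : ℝ) - 1)) B.domain)
    (hc : IsAlgebraic ℚ (√2 / 4 : ℝ)) :
    toFormalPeriod (of K) =
      toFormalPeriod (of (IntegralRep.unit.constMul (√2 / 4) hc)) * toFormalPeriod (of B) := by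
  rw [(soloInformed_ellipticK_half_equivalent_beta K B hKd hKi hBd hBi hc).toFormalPeriod_eq,
    toFormalPeriod_of_constMul]

/-- **THEOREM XVII-L (value form).** `K(1/√2) = (√2/4)·B(¼,½)`. [this work] -/
theorem soloInformed_ellipticK_half_value (K B : IntegralRep 1)
    (hKd : K.domain = {x : Fin 1 → ℝ | x 0 ∈ Ioo (0:ℝ) 1})
    (hKi : EqOn K.integrand
      (fun x => (√(1 - x 0 ^ 2))⁻¹ * (√(1 - (1 / 2 : ℝ) * x 0 ^ 2))⁻¹) K.domain)
    (hBd : B.domain = {t | t 0 ∈ Ioo (0:ℝ) 1})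
    (hBi : EqOn B.integrand
      (fun t => (t 0) ^ (((1 / 4 : ℚ) : ℝ) - 1) * (1 - t 0) ^ (((1 / 2 : ℚ) : ℝ) - 1)) B.domain) :
    K.value = √2 / 4 * B.value := by
  have h := (soloInformed_ellipticK_half_equivalent_beta K B hKd hKi hBd hBi
    soloInformed_isAlgebraic_sqrt_two_div_four).toFormalPeriod_eq
  have hv := congrArg evalP h
  simpa [evalP_toFormalPeriod_of, IntegralRep.value_constMul] using hv

/-- **`K(1/√2) = Γ(¼)²/(4√π)`** (Gauss's lemniscatic value, here via the two moves and
`B(¼,½) = Γ(¼)²/√(2π)`). [folklore] -/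
theorem soloInformed_ellipticK_half_value_gamma (K : IntegralRep 1)
    (hKd : K.domain = {x : Fin 1 → ℝ | x 0 ∈ Ioo (0:ℝ) 1})
    (hKi : EqOn K.integrand
      (fun x => (√(1 - x 0 ^ 2))⁻¹ * (√(1 - (1 / 2 : ℝ) * x 0 ^ 2))⁻¹) K.domain) :
    K.value = Real.Gamma (1 / 4) ^ 2 / (4 * √Real.pi) := by
  obtain ⟨B, hBd, hBi⟩ := exists_betaRep' (1 / 4) (1 / 2) (by norm_num) (by norm_num)
  have hBi' : EqOn B.integrand
      (fun t => (t 0) ^ (((1 / 4 : ℚ) : ℝ) - 1) * (1 - t 0) ^ (((1 / 2 : ℚ) : ℝ) - 1)) B.domain := by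
    rw [hBi]; exact fun _ _ => rfl
  rw [soloInformed_ellipticK_half_value K B hKd hKi hBd hBi',
    soloInformed_value_betaQuarterHalf B hBd hBi']
  have hπ : 0 < Real.pi := Real.pi_pos
  have h2 : (0:ℝ) < √2 := Real.sqrt_pos.2 two_pos
  have hsπ : 0 < √Real.pi := Real.sqrt_pos.2 hπ
  rw [Real.sqrt_mul zero_le_two]
  field_simp

/-- **`B(¼,½)² = 8·K(1/√2)²`** — the form consumed by the transcendence transfer of file IX.
[this work] -/
theorem soloInformed_beta_sq_eq_eight_mul_ellipticK_half_sq (K B : IntegralRep 1)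
    (hKd : K.domain = {x : Fin 1 → ℝ | x 0 ∈ Ioo (0:ℝ) 1})
    (hKi : EqOn K.integrand
      (fun x => (√(1 - x 0 ^ 2))⁻¹ * (√(1 - (1 / 2 : ℝ) * x 0 ^ 2))⁻¹) K.domain)
    (hBd : B.domain = {t | t 0 ∈ Ioo (0:ℝ) 1})
    (hBi : EqOn B.integrand
      (fun t => (t 0) ^ (((1 / 4 : ℚ) : ℝ) - 1) * (1 - t 0) ^ (((1 / 2 : ℚ) : ℝ) - 1)) B.domain) :
    B.value ^ 2 = 8 * K.value ^ 2 := by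
  rw [soloInformed_ellipticK_half_value K B hKd hKi hBd hBi, mul_pow, div_pow,
    Real.sq_sqrt zero_le_two]
  ring

end Summit.KontsevichZagierPeriods.KontsevichZagierPeriods.Theorems

end
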